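import Literature.Claims.NS.Lietz2026
import Literature.Analysis.FunctionSpaces.TorusFourierSeries
import Literature.Analysis.FunctionSpaces.TorusSpaceTime
import Mathlib.NumberTheory.Real.GoldenRatio
import HarnessLib

/-!
# NS-claims map, C167 (Lietz 2026): Thm 13.3's display (129) in its PRINT-LITERAL reading is TRUE —
# a per-solution, per-slab dyadic shell decay constant (kernel, records-grade TRUE column)

Claim C167 of cell `ns-claims` (D-0090): Justin K. Lietz, *A Phase Calculus Proof of Global Regularity
for the Three-Dimensional Navier–Stokes Equations*, Zenodo record 20091655 (bib `Lietz2026`), skeleton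
`Literature.Claims.NS.Lietz2026` (typist ns-claims-typist-7 g8, p543717).  The row's located step is
`Step_T133_uniform` (ADJUDICATED #154: the display (129) «Ω_k(t) ≤ C_phys(T) 2^{−β_ξ k}» read WITH its
ledger-constant clause is kernel-false).  The PRINT-LITERAL reading `Step_T133` (skeleton l.339: one
constant per classical solution and per closed slab `[0, T]`) is TRUE by smoothness alone, as the REF
recorded (RETYPE §1d R1): along a classical solution on `[0, T] × 𝕋³` the field
`(1 − (4π²)⁻¹Δ)² ω(t)` is jointly continuous, hence bounded by some `K` on the compact slab, so
`‖ω̂(t)(n)‖ ≤ K (1 + |n|²)⁻²` (tree `Torus.norm_mFourierCoeff_le_of_iterate_bound`, Grafakos Prop. 3.2.6),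
and on the sharp block `dyShell k` (`|n|² > 2^{2k−1}`, at most `2^{3k+9}` lattice points)
`Om k (u t) ≤ 2^{3k+9} · 16 K² · 2^{−8k} = 2^{13} K² · 2^{−5k} ≤ 2^{13} K² · 2^{−β_ξ k}` because
`β_ξ = 6 log₂ φ ≤ 5` (`φ ≤ 7/4`, `(7/4)⁶ ≤ 2⁵`).  The exponent `β_ξ` carries no information at this
grain — any polynomial rate holds.

* `betaXi_le_five : Literature.Claims.NS.Lietz2026.betaXi ≤ 5`;
* `step_T133_holds : Literature.Claims.NS.Lietz2026.Step_T133`;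
* `step_P101_holds : Literature.Claims.NS.Lietz2026.Step_P101` (Prop 10.1 as typed: the abstract readout
  structure is inhabited — the vacuity witness `Ω^ξ := Ω`, other readouts `0`);
* (companion file `SoloSalvageLietz2026TransferTail.lean`, importing this one:
  `step_T124_holds : Literature.Claims.NS.Lietz2026.Step_T124`, Thm 12.4 (108) with its free `L¹` term).

Records-grade TRUE-column object of #154 (announce-first INBOX 16:28:47Z by the skeleton's typist;
kit handed to a salvage seat for filing; public headlines fully qualified).  Axioms: `propext`, `Classical.choice`, `Quot.sound` only.
WHAT THIS IS NOT: not a claim about NS regularity or blow-up; not a claim about any author beyond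
the typed locator.
-/

noncomputable section

open Set MeasureTheory

-- The summit's canonical theorem namespace repeats the summit name (single-conjunct summit).
set_option linter.dupNamespace false

namespace Summit.NavierStokesRegularity.NavierStokesRegularity.Theorems.Lietz2026

open Literature.Analysis Literature.Analysis.FluidPDE Literature.Analysis.FunctionSpaces
open Literature.Claims.NS.Lietz2026
open Literature.Claims.NS.Higgins2026 (T3 E3 C3 Z3 coeff)

/-! ## The exponent: `β_ξ ≤ 5` -/

/-- `0 < φ` for the skeleton's `phi = (1 + √5)/2`. [folklore] -/
private theorem phi_pos' : 0 < phi := by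
  rw [show phi = Real.goldenRatio from rfl]; exact Real.goldenRatio_pos

/-- `φ ≤ 7/4` (`√5 ≤ 5/2`). [folklore] -/
private theorem phi_le_seven_fourths : phi ≤ 7 / 4 := by
  have h5 : Real.sqrt 5 ≤ 5 / 2 := by
    rw [show (5 / 2 : ℝ) = Real.sqrt ((5 / 2) ^ 2) by rw [Real.sqrt_sq]; norm_num]
    exact Real.sqrt_le_sqrt (by norm_num)
  show (1 + Real.sqrt 5) / 2 ≤ 7 / 4
  linarith

/-- `7/4 ≤ 2^{5/6}` (`(7/4)⁶ = 117649/4096 ≤ 32 = 2⁵`, sixth roots). [folklore] -/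
private theorem seven_fourths_le_rpow : (7 / 4 : ℝ) ≤ (2 : ℝ) ^ ((5 : ℝ) / 6) := by
  have h6 : ((7 / 4 : ℝ) ^ (6 : ℕ)) ≤ (2 : ℝ) ^ (5 : ℕ) := by norm_num
  have h := Real.rpow_le_rpow (by positivity) h6 (by norm_num : (0 : ℝ) ≤ ((6 : ℕ) : ℝ)⁻¹)
  rw [Real.pow_rpow_inv_natCast (by norm_num) (by norm_num)] at h
  refine h.trans (le_of_eq ?_)
  rw [← Real.rpow_natCast (2 : ℝ) 5, ← Real.rpow_mul (by norm_num)]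
  norm_num

/-- **`β_ξ = 6 log₂ φ ≤ 5`.** [cite: Lietz2026, Thm 7.1 (34) p.7 l.37–52] -/
theorem betaXi_le_five : Literature.Claims.NS.Lietz2026.betaXi ≤ 5 := by
  have hlog : Real.logb 2 phi ≤ 5 / 6 :=
    (Real.logb_le_iff_le_rpow one_lt_two phi_pos').2 (phi_le_seven_fourths.trans seven_fourths_le_rpow)
  unfold betaXi
  linarith

/-! ## The sharp block has at most `2^{3k+9}` lattice points -/

/-- `#dyShell k ≤ (2·2^{k+1} + 1)³ ≤ 2^{3k+9}` (lattice points of the sharp block; Bernstein count). [folklore] -/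
theorem card_dyShell_le (k : ℕ) : ((dyShell k).card : ℝ) ≤ (2 : ℝ) ^ (3 * k + 9) := by
  have h1 : (dyShell k).card ≤
      (Fintype.piFinset fun _ : Fin 3 => Finset.Icc (-(2 ^ (k + 1) : ℤ)) (2 ^ (k + 1))).card :=
    Finset.card_filter_le _ _
  rw [Fintype.card_piFinset, Finset.prod_const, Finset.card_univ, Fintype.card_fin,
    Int.card_Icc] at h1
  have h2 : ((2 : ℤ) ^ (k + 1) + 1 - -(2 ^ (k + 1))).toNat = 2 ^ (k + 2) + 1 := by
    have : (2 : ℤ) ^ (k + 1) + 1 - -(2 ^ (k + 1)) = ((2 ^ (k + 2) + 1 : ℕ) : ℤ) := by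
      push_cast; ring
    rw [this, Int.toNat_natCast]
  rw [h2] at h1
  have h3 : (2 ^ (k + 2) + 1 : ℕ) ^ 3 ≤ 2 ^ (3 * k + 9) := by
    calc (2 ^ (k + 2) + 1 : ℕ) ^ 3 ≤ (2 ^ (k + 3)) ^ 3 := by
          gcongr
          calc 2 ^ (k + 2) + 1 ≤ 2 ^ (k + 2) + 2 ^ (k + 2) := by gcongr; exact Nat.one_le_two_pow
            _ = 2 ^ (k + 3) := by ring
      _ = 2 ^ (3 * k + 9) := by rw [← pow_mul]; ring_nf
  exact_mod_cast h1.trans h3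

/-- On the sharp block, `2^{2k}/2 < |n|²`, hence `2^{8k} ≤ 16 (1 + |n|²)⁴`. [folklore] -/
private theorem two_pow_eight_le_of_mem_dyShell {k : ℕ} {n : Z3} (hn : n ∈ dyShell k) :
    (2 : ℝ) ^ (8 * k) ≤ 16 * (1 + Torus.freqNormSq n) ^ 4 := by
  have h := two_pow_lt_of_mem_dyShell hn
  have h0 : 0 ≤ Torus.freqNormSq n := Torus.freqNormSq_nonneg n
  have h1 : (2 : ℝ) ^ (2 * k) ≤ 2 * (1 + Torus.freqNormSq n) := by linarith
  calc (2 : ℝ) ^ (8 * k) = ((2 : ℝ) ^ (2 * k)) ^ 4 := by rw [← pow_mul]; ring_nf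
    _ ≤ (2 * (1 + Torus.freqNormSq n)) ^ 4 := by gcongr
    _ = 16 * (1 + Torus.freqNormSq n) ^ 4 := by ring

/-! ## Smoothness of the vorticity (slice and space–time) -/

/-- Components of `vort`. [folklore] -/
private theorem vort_apply_zero (v : T3 → E3) (x : T3) :
    vort v x 0 = Torus.partialDeriv 1 v x 2 - Torus.partialDeriv 2 v x 1 := by
  simp [vort]

/-- Components of `vort`. [folklore] -/
private theorem vort_apply_one (v : T3 → E3) (x : T3) :
    vort v x 1 = Torus.partialDeriv 2 v x 0 - Torus.partialDeriv 0 v x 2 := by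
  simp [vort]

/-- Components of `vort`. [folklore] -/
private theorem vort_apply_two (v : T3 → E3) (x : T3) :
    vort v x 2 = Torus.partialDeriv 0 v x 1 - Torus.partialDeriv 1 v x 0 := by
  simp [vort]

/-- The vorticity of a smooth field is smooth (pattern of the C167 TRUE-column kit of
ns-claims-typist-4 g6). [folklore] -/
private theorem isSmooth_vort {v : T3 → E3} (hv : Torus.IsSmooth v) : Torus.IsSmooth (vort v) := by
  have hc : ∀ i j : Fin 3, Torus.IsSmooth fun x => Torus.partialDeriv i v x j :=
    fun i j => (hv.partialDeriv i).apply j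
  have h0 : Torus.IsSmooth fun x => vort v x 0 := by
    simp_rw [vort_apply_zero]; exact (hc 1 2).sub (hc 2 1)
  have h1 : Torus.IsSmooth fun x => vort v x 1 := by
    simp_rw [vort_apply_one]; exact (hc 2 0).sub (hc 0 2)
  have h2 : Torus.IsSmooth fun x => vort v x 2 := by
    simp_rw [vort_apply_two]; exact (hc 0 1).sub (hc 1 0)
  show ContDiff ℝ _ (Torus.lift (vort v))
  refine (contDiff_piLp (p := 2)).2 fun i => ?_
  fin_cases i
  · exact h0
  · exact h1
  · exact h2

/-- The vorticity of a jointly smooth torus field is jointly smooth (componentwise, on a time set of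
unique differentiability). [folklore] -/
theorem isSmoothSpaceTimeOn_vort {S : Set ℝ} {u : ℝ → T3 → E3}
    (hu : Torus.IsSmoothSpaceTimeOn S u) (hS : UniqueDiffOn ℝ S) :
    Torus.IsSmoothSpaceTimeOn S (fun t => vort (u t)) := by
  have hc : ∀ i j : Fin 3, Torus.IsSmoothSpaceTimeOn S (fun t x => Torus.partialDeriv i (u t) x j) :=
    fun i j => (hu.partialDeriv hS i).apply j
  have h0 : Torus.IsSmoothSpaceTimeOn S fun t x => vort (u t) x 0 := by
    simp_rw [vort_apply_zero]; exact (hc 1 2).sub (hc 2 1)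
  have h1 : Torus.IsSmoothSpaceTimeOn S fun t x => vort (u t) x 1 := by
    simp_rw [vort_apply_one]; exact (hc 2 0).sub (hc 0 2)
  have h2 : Torus.IsSmoothSpaceTimeOn S fun t x => vort (u t) x 2 := by
    simp_rw [vort_apply_two]; exact (hc 0 1).sub (hc 1 0)
  show ContDiffOn ℝ _ (Torus.stLift fun t => vort (u t)) _
  refine (contDiffOn_piLp (p := 2)).2 fun i => ?_
  fin_cases i
  · exact h0
  · exact h1
  · exact h2

/-! ## The shell estimate from a sup bound on `(1 − (4π²)⁻¹Δ)² ω` -/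

/-- **Core estimate.** If `‖((1 − (4π²)⁻¹Δ)² ω)(x)‖ ≤ K` on `𝕋³` (`ω = vort v` smooth), then
`Om k v ≤ 2^{13} K² · 2^{−β_ξ k}`: each `‖ω̂(n)‖ ≤ K (1 + |n|²)⁻²` (Grafakos Prop. 3.2.6 via the tree's
`Torus.norm_mFourierCoeff_le_of_iterate_bound`), the block has `≤ 2^{3k+9}` points with
`2^{8k} ≤ 16 (1 + |n|²)⁴`, and `2^{−5k} ≤ 2^{−β_ξ k}`. [cite: Lietz2026, Thm 13.3 (129) p.21 l.2–4] -/
private theorem om_le_of_iterate_bound {v : T3 → E3} (hv : Torus.IsSmooth (vort v)) {K : ℝ}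
    (hK : ∀ x, ‖((fun b : T3 → E3 => fun x => b x - (4 * Real.pi ^ 2)⁻¹ • Torus.laplacian b x)^[2]
      (vort v)) x‖ ≤ K) (k : ℕ) :
    Om k v ≤ 2 ^ 13 * K ^ 2 * (2 : ℝ) ^ (-(betaXi * k)) := by
  have hK0 : 0 ≤ K := (norm_nonneg _).trans (hK 0)
  -- coefficient decay
  have hcoef : ∀ n : Z3, ‖coeff (vort v) n‖ ≤ K * ((1 + Torus.freqNormSq n) ^ 2)⁻¹ := fun n =>
    Torus.norm_mFourierCoeff_le_of_iterate_bound hv hK n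
  -- termwise bound on the block
  have hterm : ∀ n ∈ dyShell k, ‖coeff (vort v) n‖ ^ 2 ≤ 16 * K ^ 2 * ((2 : ℝ) ^ (8 * k))⁻¹ := by
    intro n hn
    have h1 : 0 < 1 + Torus.freqNormSq n := by linarith [Torus.freqNormSq_nonneg n]
    have hc := hcoef n
    have hsq : ‖coeff (vort v) n‖ ^ 2 ≤ (K * ((1 + Torus.freqNormSq n) ^ 2)⁻¹) ^ 2 :=
      pow_le_pow_left₀ (norm_nonneg _) hc 2
    have h8 := two_pow_eight_le_of_mem_dyShell hn
    have hpos : (0 : ℝ) < 2 ^ (8 * k) := by positivity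
    calc ‖coeff (vort v) n‖ ^ 2 ≤ (K * ((1 + Torus.freqNormSq n) ^ 2)⁻¹) ^ 2 := hsq
      _ = K ^ 2 * ((1 + Torus.freqNormSq n) ^ 4)⁻¹ := by
          field_simp
      _ ≤ K ^ 2 * (16 * ((2 : ℝ) ^ (8 * k))⁻¹) := by
          have hinv : ((1 + Torus.freqNormSq n) ^ 4)⁻¹ = 16 * (16 * (1 + Torus.freqNormSq n) ^ 4)⁻¹ := by
            field_simp
          rw [hinv]
          exact mul_le_mul_of_nonneg_left
            (mul_le_mul_of_nonneg_left (inv_anti₀ hpos h8) (by norm_num)) (sq_nonneg K)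
      _ = 16 * K ^ 2 * ((2 : ℝ) ^ (8 * k))⁻¹ := by ring
  -- sum over the block
  have hsum : Om k v ≤ (dyShell k).card * (16 * K ^ 2 * ((2 : ℝ) ^ (8 * k))⁻¹) := by
    unfold Om
    have := Finset.sum_le_card_nsmul (dyShell k) (fun n => ‖coeff (vort v) n‖ ^ 2)
      (16 * K ^ 2 * ((2 : ℝ) ^ (8 * k))⁻¹) hterm
    rwa [nsmul_eq_mul] at this
  have hcard := card_dyShell_le k
  -- exponent comparison
  have hβ : (2 : ℝ) ^ (-(5 * (k : ℝ))) ≤ (2 : ℝ) ^ (-(betaXi * k)) := by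
    apply Real.rpow_le_rpow_of_exponent_le one_le_two
    have hk : (0 : ℝ) ≤ k := Nat.cast_nonneg k
    nlinarith [betaXi_le_five]
  have h5 : (2 : ℝ) ^ (3 * k + 9) * ((2 : ℝ) ^ (8 * k))⁻¹ = 2 ^ 9 * (2 : ℝ) ^ (-(5 * (k : ℝ))) := by
    rw [Real.rpow_neg (by norm_num), ← Real.rpow_natCast 2 (3 * k + 9), ← Real.rpow_natCast 2 (8 * k),
      show ((3 * k + 9 : ℕ) : ℝ) = 9 + 3 * (k : ℝ) by push_cast; ring,
      show ((8 * k : ℕ) : ℝ) = 3 * (k : ℝ) + 5 * (k : ℝ) by push_cast; ring,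
      Real.rpow_add two_pos, Real.rpow_add two_pos, mul_inv]
    have h9 : (2 : ℝ) ^ (9 : ℝ) = 2 ^ 9 := by exact_mod_cast Real.rpow_natCast 2 9
    have hne : (2 : ℝ) ^ (3 * (k : ℝ)) ≠ 0 := (Real.rpow_pos_of_pos two_pos _).ne'
    rw [h9]
    field_simp
  calc Om k v ≤ (dyShell k).card * (16 * K ^ 2 * ((2 : ℝ) ^ (8 * k))⁻¹) := hsum
    _ ≤ (2 : ℝ) ^ (3 * k + 9) * (16 * K ^ 2 * ((2 : ℝ) ^ (8 * k))⁻¹) := by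
        gcongr
    _ = 2 ^ 13 * K ^ 2 * (2 : ℝ) ^ (-(5 * (k : ℝ))) := by
        rw [show (2 : ℝ) ^ (3 * k + 9) * (16 * K ^ 2 * ((2 : ℝ) ^ (8 * k))⁻¹) =
          16 * K ^ 2 * ((2 : ℝ) ^ (3 * k + 9) * ((2 : ℝ) ^ (8 * k))⁻¹) by ring, h5]
        ring
    _ ≤ 2 ^ 13 * K ^ 2 * (2 : ℝ) ^ (-(betaXi * k)) := by
        gcongr

/-! ## Step 11 (print-literal) HOLDS -/

/-- **Step 11 `Step_T133` HOLDS (kernel)** — Thm 13.3 (129) PRINT-LITERAL: along every classical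
solution on a closed slab `[0, T] × 𝕋³` there is ONE constant `C` with `Ω_k(t) ≤ C · 2^{−β_ξ k}` for all
shells `k` and all `t ∈ [0, T]` (`C = 2^{13} K²`, `K` a sup bound of `(1 − (4π²)⁻¹Δ)² ω` on the compact
slab; for `T < 0` the slab is empty, for `T = 0` it is the single smooth slice `u 0`).
[cite: Lietz2026, Thm 13.3 (129) p.21 l.2–4] -/
theorem step_T133_holds : Literature.Claims.NS.Lietz2026.Step_T133 := by
  intro ν _hν T u p hsol
  set F : (T3 → E3) → (T3 → E3) :=
    fun b => fun x => b x - (4 * Real.pi ^ 2)⁻¹ • Torus.laplacian b x with hF_def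
  rcases lt_trichotomy T 0 with hT | hT | hT
  · -- empty slab
    refine ⟨0, fun k t ht => ?_⟩
    exact absurd (ht.1.trans ht.2) (not_le.2 hT)
  · -- the single slice `t = 0`
    subst hT
    have h0 : (0 : ℝ) ∈ Icc (0 : ℝ) 0 := ⟨le_rfl, le_rfl⟩
    have hsm : Torus.IsSmooth (vort (u 0)) := isSmooth_vort (hsol.smooth_velocity.isSmooth_slice h0)
    have hF1 : ∀ {b : T3 → E3}, Torus.IsSmooth b → Torus.IsSmooth (F b) := fun {b} hb =>
      hb.sub ((hb.laplacian).smul _)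
    have hc : Continuous (F^[2] (vort (u 0))) := by
      rw [Function.iterate_succ_apply', Function.iterate_one]
      exact (hF1 (hF1 hsm)).continuous
    obtain ⟨K, hK⟩ := isCompact_univ.exists_bound_of_continuousOn hc.continuousOn
    refine ⟨2 ^ 13 * K ^ 2, fun k t ht => ?_⟩
    have ht0 : t = 0 := le_antisymm ht.2 ht.1
    subst ht0
    exact om_le_of_iterate_bound hsm (fun x => hK x (mem_univ x)) k
  · -- a genuine slab: uniform sup bound from joint smoothness
    have hS : UniqueDiffOn ℝ (Icc (0 : ℝ) T) := uniqueDiffOn_Icc hT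
    have hω : Torus.IsSmoothSpaceTimeOn (Icc 0 T) (fun t => vort (u t)) :=
      isSmoothSpaceTimeOn_vort hsol.smooth_velocity hS
    have hF1 : ∀ {w : ℝ → T3 → E3}, Torus.IsSmoothSpaceTimeOn (Icc 0 T) w →
        Torus.IsSmoothSpaceTimeOn (Icc 0 T) (fun t => F (w t)) := fun {w} hw =>
      hw.sub ((hw.laplacian hS).const_smul _)
    have hFF : Torus.IsSmoothSpaceTimeOn (Icc 0 T) (fun t => F^[2] (vort (u t))) := by
      have := hF1 (hF1 hω)
      refine (show (fun t => F^[2] (vort (u t))) = fun t => F (F (vort (u t))) from ?_) ▸ this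
      funext t
      rw [Function.iterate_succ_apply', Function.iterate_one]
    obtain ⟨K, hK⟩ := hFF.exists_norm_le_of_isCompact isCompact_Icc Subset.rfl
    refine ⟨2 ^ 13 * K ^ 2, fun k t ht => ?_⟩
    have hsm : Torus.IsSmooth (vort (u t)) := isSmooth_vort (hsol.smooth_velocity.isSmooth_slice ht)
    exact om_le_of_iterate_bound hsm (fun x => hK t ht x) k

/-! ## Step 3 (Prop 10.1 as typed) HOLDS — the vacuity witness -/

/-- **Step 3 `Step_P101` HOLDS (kernel)**: the abstract readout structure is inhabited along any
trajectory — `Ω^ξ_k := Ω_k`, all other readouts `0` (the vacuity witness recorded by the REF, RETYPE §1b,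
and by ADJUDICATED #154: the readouts carry no formula in `u`). [cite: Lietz2026, Prop 10.1 (84)–(85) p.14 l.39–90] -/
theorem step_P101_holds : Literature.Claims.NS.Lietz2026.Step_P101 := by
  intro ν _hν T u p _h
  exact ⟨⟨fun k t => Om k (u t), fun _ _ => 0, fun _ _ => 0, fun _ _ => 0, fun _ _ => 0, 0, 0,
    fun k t => by simp⟩⟩

end Summit.NavierStokesRegularity.NavierStokesRegularity.Theorems.Lietz2026

end
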